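import Summits.BirchSwinnertonDyer.Rank1Residual.Supersingular.X7VisibilityRecordsC5
import Literature.NumberTheory.EllipticCurves.Rank1Residual.Typed.X10bHeegnerIndexCertificate
import Literature.NumberTheory.EllipticCurves.ComplexMultiplicationHasCMIffHoldsProofs
import HarnessLib

/-!
# N5 (X7 ∧ `r_an = 0`) at a prime of EXOTIC IMAGE: `BSD(E,p)` from a VISIBLE `Ш[p]` (lower half, Cassels–Tate) and CHA's Heegner-index bound (upper half) — no `surj(p)`; the pair `363312bl1 @ 5` (image `5Nn`)

Cell `b2b-bsdres`, supersingular family, prover A = unit `b2b-bsdres-x10b` (gen 24).  THEOREMS ONLY; no definition, no named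
fact introduced (the inputs are the tree's existing named facts), nothing booked; X7 stays CONSTRUCTION-SHAPED.

HONEST FRAMING (run/shared/lean/b2b/bsd-rank1-residual/, verbatim in every file): the goal of the cell is to
DELETE the COMBINATION-SHAPED residual classes of the Birch–Swinnerton-Dyer formula for ALL analytic-rank `≤ 1`
elliptic curves over `ℚ` — "full BSD formula for every rank `≤ 1` curve in class `C`" assembled STRICTLY from
published theorems — so that the rank-`≤ 1` remainder becomes exactly the CONSTRUCTION-SHAPED classes, which are
TYPED (missing-input `Prop`s), NOT attempted.  This is not "finishing BSD".

## Why (x10b gen 24 SURJ AUDIT)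

The landed visibility offers on `363312bl1 @ 5` (`bsdp_x7r0vis_363312bl1_5[_of_congr]` of `X7VisibilityRecordsC5`,
`bsdp_x7r0vis5_363312bl1_5[_of_congr]` of `X7Visibility5Records04`, and their gen-22 twins) DISPLAY the binder
`(hsurj : Surj W 5)` because their closing step is Wuthrich 2014 Prop. 21 (`sha_dvd_analyticSha`: the constant `C` is
prime to `p` only at primes of surjective or Borel image).  For THIS curve that binder is FALSE: Cremona's image code is
`5Nn`, and exactly `j(E) = 54775974000/20511149 = J₇(5)` with `J₇(t) = 5³(t+1)(2t+1)³(2t²−3t+3)³/(t²+t−1)⁵` the `j`-map of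
`X⁺_ns(5)` (Zywina, arXiv:1508.07660, Thm. 1.4: the image of `ρ̄_{E,5}` is conjugate to a subgroup of the normaliser of a
non-split Cartan subgroup; Frobenius statistics concordant — `0/192` split-type classes at the good `ℓ < 1200`).  So those
offers are VACUOUS.  This file gives the pair a NON-vacuous offer by a different upper half.

## What

* **`X7RankZero.bsdp_of_casselsTate_of_congr_of_places_of_cha`** — the SHAPE: X7 ∧ `r_an = 0` ∧ odd `p` ∧
  `ord_p #Ш_an = 2` ∧ NON-CM, a `p`-CONGRUENT curve `W'` with the three-kind refined visibility count (exactly the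
  hypotheses of `X7RankZero.bsdp_of_casselsTate_of_congr_of_places_of_surj`, x10b gen 15), and — INSTEAD OF `surj(p)`
  and Wuthrich — a Heegner field `K` / Heegner point `y_K = P` of infinite order with `p ∤ d_K`, `p² ∤ N` and the INDEX
  CERTIFICATE `ord_p [E(K) : ℤ P] ≤ 1` ⟹ `BSD(E,p)`.  Chain: `Ш(E)[p] ≠ 0` (`exists_sha_ne_zero_of_congr_of_places`:
  Cremona–Mazur / Fisher visibility, Tate uniformisation `hU`/`hU2`; `E(ℚ)` finite of order prime to `p` by GZK +
  `ClassX7.irr`) ⟹ `p ∣ #Ш` (`dvd_shaOrder_of_exists_torsion`) ⟹ with Cassels–Tate squareness the LOWER half, with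
  Cha 2005 Thm. 5.2 (`Cha2005.thm52_padicValNat_shaOrder_le`: `ord_p #Ш ≤ 2·ord_p [E(K) : ℤ y_K]`, hypotheses non-CM,
  `p ∤ 2 d_K`, `p² ∤ N`, `ρ̄` IRREDUCIBLE — no surjectivity) the UPPER half: the tree's
  `Typed.bsdp_of_cha_of_casselsTate_of_dvd` (x10b gen 2, `Typed/X10bHeegnerIndexCertificate.lean`) with `k = 1`.
* **`bsdp_x7r0vischa_363312bl1_5_of_congr`**, **`bsdp_x7r0vischa_363312bl1_5`** — the per-pair OFFERS for
  `E = 363312bl1` (`⟨0, 0, 0, −23728815, −26430993414⟩`, `N = 2⁴·3³·29²`, additive at `2, 3, 29`, good supersingular at `5`,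
  `#Ш_an = 5²`, `∏ c_ℓ = 2`) with the visible partner `F = 363312bg1` (`⟨0, 0, 0, −2636535, 978925682⟩`, rank `2`):
  the bookkeeping of places is COPIED VERBATIM from `bsdp_x7r0vis_363312bl1_5_of_congr` (S = {2, 3, 5, 29}, pay at `5`,
  kind (i) elsewhere); NON-CM is PROVED in the kernel (`j(E) = 54775974000/20511149 ∉` the thirteen CM invariants, via the
  tree's PROVED `j_mem_cmJInvariants_of_hasCM_holds`); the `5`-congruence is the displayed `θ`/`hθ` (first theorem) or
  Fisher 2013 Thm. 5.8 (`hF58`, indirect family `X_E⁻(5)`, member `(λ : μ) = (−310068 : 7)`, the source's certificate).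
  DISPLAYED: the named facts `hCT`, `hCha`, `hGZK`, `hU`, `hU2` [, `hF58`]; Cremona's `r_an = 0`, `#Ш_an = q` with
  `ord_5 q = 2`; the partner's rank `hrank` and local counts `h2 h3 h5 h29` (all four have kernel certificates in the
  gen-23/24 records `natCard_ker_five_partner_363312bl1_at2/3/5/29`, and `hrank` in `two_le_rank_c363312bg1` — discharged
  in a twin once those files are built on the farm); and the HEEGNER DATUM `K, P, hK, hH, hP, hnt, hpD, hpN, hI` — per-pair
  EVIDENCE to be supplied by the instrument lane (iw-2 `WAKE-heegidx` pattern, engines `heegtwist.gp` / engine 2; Gross–Zagier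
  + BSD predict `ord_5 [E(K) : ℤ y_K] = 1` here since `#Ш_an = 25`).  Per pair (an OFFER for referee A); NOT a class theorem;
  nothing booked; the first offer on an image-`Nn` pair of N5 whose lower half is VISIBILITY.

References: [Cha2005] / [Miller2011LMS] Thm. 5.2; [CremonaMazur2000] §3; [Fisher2016Visualizing7] Thm. 4.4;
[Fisher2013QuinticTwists] Thm. 5.8; [SilvermanAEC2009] X.4.14, App. C §11; [SilvermanATAEC1994] V.3, V.5; [GrossZagier1986];
Zywina arXiv:1508.07660 Thm. 1.4 (evidence line, outside the kernel); [Cremona2006] Table 1.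
-/

set_option autoImplicit false

noncomputable section

open scoped Classical

open WeierstrassCurve Literature.NumberTheory.EllipticCurves
  Literature.NumberTheory.EllipticCurves.Rank1Residual
  Literature.NumberTheory.EllipticCurves.Rank1Residual.Typed
  Literature.NumberTheory.EllipticCurves.Rank1Residual.X11RankOneCertificates
  Literature.NumberTheory.EllipticCurves.Wuthrich2014
  Literature.NumberTheory.EllipticCurves.Fisher2016
  Literature.NumberTheory.EllipticCurves.Fisher2012
  Summit.BirchSwinnertonDyer.BirchSwinnertonDyer.Rank1Residual.IntModel
  Summit.BirchSwinnertonDyer.Rank1Residual.X11b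
open NumberField IsDedekindDomain Rat.HeightOneSpectrum

namespace Summit.BirchSwinnertonDyer.Rank1Residual.Supersingular

/-! ### §1. The SHAPE: visibility lower half + Cha upper half (no `surj(p)`) -/

/-- **X7 ∩ {r_an = 0}, odd `p`, NON-CM, `ord_p #Ш_an = 2`: `BSD(E,p)` from a `p`-CONGRUENT curve `W'` with the THREE-kind
refined visibility count (lower half, via Cassels–Tate) and a Heegner point `y_K` with index certificate
`ord_p [E(K) : ℤ y_K] ≤ 1` (upper half, Cha 2005 Thm. 5.2 — `ρ̄_{E,p}` IRREDUCIBLE suffices, which `ClassX7` gives; NO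
surjectivity).**  The `_of_cha` twin of `X7RankZero.bsdp_of_casselsTate_of_congr_of_places_of_surj` (x10b gen 15) for the
pairs of exotic image (`Nn`) where Wuthrich's Prop. 21 is silent.  Chain: `Ш(E)[p] ≠ 0`
(`exists_sha_ne_zero_of_congr_of_places`) ⟹ `p ∣ #Ш` ⟹ `Typed.bsdp_of_cha_of_casselsTate_of_dvd` with `k = 1`.
Per pair; NOT a class theorem. [cite: Miller2011LMS, Thm. 5.2 (arXiv:1010.2431 p. 11)] [cite: CremonaMazur2000, §3 and Table 1]
[cite: SilvermanATAEC1994, Ch. V Thm. 3.1, Lemma 5.2, Thm. 5.3, Cor. 5.4] [cite: SilvermanAEC2009, Thm. X.4.14] -/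
theorem X7RankZero.bsdp_of_casselsTate_of_congr_of_places_of_cha
    (hCT : exists_casselsTate_pairing (K := ℚ)) (hCha : Cha2005.thm52_padicValNat_shaOrder_le)
    (hGZK : rank_eq_analyticRank_of_analyticRank_le_one)
    (hU : Silverman1994_thmV53_tateUniformisation.{0})
    (hU2 : Silverman1994_thmV53_corV54_tateUniformisation.{0})
    (W : WeierstrassCurve ℚ) [W.IsElliptic] [W.IsGloballyMinimal] (p : ℕ) [Fact p.Prime] (hp : p ≠ 2)
    (hX : ClassX7 W p) (hcm : ¬ W.HasCM) (hr : W.analyticRank = 0) {q : ℚ} (hq : shaAn W = (q : ℂ))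
    (hv : padicValRat p q = 2)
    {N : ℕ} [NeZero N] {K : Type} [Field K] [NumberField K] (hK : IsImaginaryQuadratic K)
    (hH : SatisfiesHeegnerHypothesis N K) {P : (W.baseChange K).toAffine.Point}
    (hP : IsHeegnerPoint N W K P) (hnt : ¬ IsOfFinAddOrder P)
    (hpD : ¬ (p : ℤ) ∣ NumberField.discr K) (hpN : ¬ p ^ 2 ∣ N)
    (hI : padicValNat p (AddSubgroup.zmultiples P).index ≤ 1)
    (W' : WeierstrassCurve ℚ) [W'.IsElliptic]
    (θ : geomTorsion W' (p : ℤ) ≃+ geomTorsion W (p : ℤ))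
    (hθ : ∀ (σ : Field.absoluteGaloisGroup ℚ) (P : geomTorsion W' (p : ℤ)), θ (σ • P) = σ • θ P)
    (S T : Finset (HeightOneSpectrum (𝓞 ℚ))) (hTS : T ⊆ S)
    (hS : ∀ w : HeightOneSpectrum (𝓞 ℚ), w ∉ S →
      W.HasGoodReductionAt w ∧ W'.HasGoodReductionAt w ∧ (p : 𝓞 ℚ) ∉ w.asIdeal)
    (hT : (∏ w ∈ T, Nat.card (nsmulAddMonoidHom p :
        (W'.baseChange (w.adicCompletion ℚ)).toAffine.Point →+ _).ker *
        Nat.card (w.adicCompletionIntegers ℚ ⧸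
          Ideal.span {(p : w.adicCompletionIntegers ℚ)})) < p ^ W'.mordellWeilRank)
    (hplaces : ∀ w ∈ S, w ∉ T →
      ((p : 𝓞 ℚ) ∉ w.asIdeal ∧ Nat.card (nsmulAddMonoidHom p :
          (W'.baseChange (w.adicCompletion ℚ)).toAffine.Point →+ _).ker = 1) ∨
      (W.HasSplitMultiplicativeReductionAt w ∧ W'.HasSplitMultiplicativeReductionAt w ∧
        Nat.card (nsmulAddMonoidHom p :
          (W.baseChange (w.adicCompletion ℚ)).toAffine.Point →+ _).ker ≤ p) ∨
      (W.HasMultiplicativeReductionAt w ∧ W'.HasMultiplicativeReductionAt w ∧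
        (∃ r : w.adicCompletion ℚ, algebraMap ℚ (w.adicCompletion ℚ) (-(W.c₄ / W.c₆)) =
          r ^ 2 * algebraMap ℚ (w.adicCompletion ℚ) (-(W'.c₄ / W'.c₆))) ∧
        (∀ ζ : w.adicCompletion ℚ, ζ ^ p = 1 → ζ = 1))) :
    BSDp W p := by
  haveI hfin : Finite W.toAffine.Point := finite_point_of_analyticRank_eq_zero W hGZK hr
  have hirr : Irr W p := ClassX7.irr W p hp hX
  have hcop : (Nat.card W.toAffine.Point).Coprime p := coprime_natCard_point_of_irr W p hirr
  have hex : ∃ c : W.sha, c ≠ 0 ∧ p • c = 0 :=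
    W.exists_sha_ne_zero_of_congr_of_places hU hU2 hp W' θ hθ S T hTS hS hfin hcop hT hplaces
  have hdvd : p ^ (2 * 1 - 1) ∣ W.shaOrder := by
    simpa using dvd_shaOrder_of_exists_torsion W p hex
  have hr1 : W.analyticRank ≤ 1 := by rw [hr]; norm_num
  have hv' : padicValRat p q = 2 * (1 : ℕ) := by rw [hv]; norm_num
  exact Typed.bsdp_of_cha_of_casselsTate_of_dvd W p hGZK hCT hCha hcm hr1 hK hH hP hnt hp hpD hpN hirr
    (k := 1) hI hq hv' hdvd

/-! ### §2. `363312bl1 @ 5` (X7 ∧ `r_an = 0`, image `5Nn`, `#Ш_an = 5²`, `∏c = 2`) ← `363312bg1` (Cremona, rank 2) -/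

/-- `363312bl1` has no complex multiplication: `j(E) = 54775974000/20511149` (`= 2¹¹·3³·5³·13³/29⁵`, not an integer) is
none of the thirteen rational CM invariants — kernel arithmetic on the literal model plus the tree's PROVED classification
`j_mem_cmJInvariants_of_hasCM_holds` (Silverman AEC App. C §11; Heegner–Stark). [cite: SilvermanAEC2009, App. C §11 Example 11.3.1–11.3.2] -/
theorem not_hasCM_c363312bl1 {W : WeierstrassCurve ℚ} [W.IsElliptic]
    (hWeq : W = ⟨0, 0, 0, -23728815, -26430993414⟩) : ¬ W.HasCM := by
  intro h
  have hj : W.j ∈ cmJInvariants := j_mem_cmJInvariants_of_hasCM_holds W h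
  have hjv : W.j = (54775974000 : ℚ) / 20511149 := by
    subst hWeq
    norm_num [WeierstrassCurve.j, WeierstrassCurve.c₄, WeierstrassCurve.b₂, WeierstrassCurve.b₄,
      WeierstrassCurve.Δ, WeierstrassCurve.b₆, WeierstrassCurve.b₈]
  rw [hjv] at hj
  revert hj
  norm_num [cmJInvariants]

/-- **`BSD(E,5)` for `363312bl1` (image `5Nn`) — OFFERED with a VISIBLE lower half and CHA's upper half, NO `surj(5)`.**
`E = ⟨0, 0, 0, −23728815, −26430993414⟩` (N5: class X7, additive at `2, 3, 29`, good supersingular at `5`, `r_an = 0`,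
`#Ш_an = 5²`, `∏c = 2`; mod-5 image in the normaliser of a non-split Cartan: `j(E) = J₇(5)` on `X⁺_ns(5)`, so the landed
`bsdp_x7r0vis_363312bl1_5_of_congr`, whose binder `hsurj : Surj W 5` is FALSE, is vacuous — THIS is its repair).  Lower
half: the `5`-congruent rank-2 partner `F = 363312bg1` = `⟨0, 0, 0, −2636535, 978925682⟩` makes `Ш(E)[5] ≠ 0` visible
(places bookkeeping VERBATIM from the source: `S = {2, 3, 5, 29}`, pay `5·#F(ℚ_5)[5] = 5 < 25 ≤ 5^{rank F}` at `5`, kind (i)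
`#F(ℚ_v)[5] = 1` at `2, 3, 29`), Cassels–Tate makes it `5² ∣ #Ш`.  Upper half: Cha 2005 Thm. 5.2 with a Heegner point
`y_K = P` of index valuation `ord_5 [E(K) : ℤ P] ≤ 1` — irreducibility from `ClassX7`, NON-CM PROVED (`not_hasCM_c363312bl1`).
DISPLAYED binders: the named facts `hCT` (Cassels–Tate), `hCha` (Cha 2005 / Miller Thm. 5.2), `hGZK`, `hU`/`hU2` (Tate
uniformisation); Cremona's `r_an = 0` and `#Ш_an = q`, `ord_5 q = 2`; the congruence `θ`/`hθ`; the partner's `hrank` and local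
counts `h2 h3 h5 h29` (kernel certificates exist: `two_le_rank_c363312bg1`, `natCard_ker_five_partner_363312bl1_at2/3/5/29` —
discharged in a twin); the HEEGNER DATUM `hK hH hP hnt hpD hpN hI` (per-pair evidence wanted from the instrument lane; GZ + BSD
predict `ord_5 [E(K) : ℤ y_K] = 1`).  Per pair (an OFFER for referee A); NOT a class theorem; nothing booked.
[cite: Miller2011LMS, Thm. 5.2 (arXiv:1010.2431 p. 11)] [cite: CremonaMazur2000, §3 and Table 1]
[cite: SilvermanAEC2009, VII.5 Prop. 5.1 and Thm. X.4.14] [cite: Cremona2006, Table 1 (Cremona labels 363312bl1, 363312bg1)] -/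
theorem bsdp_x7r0vischa_363312bl1_5_of_congr
    (hCT : exists_casselsTate_pairing (K := ℚ)) (hCha : Cha2005.thm52_padicValNat_shaOrder_le)
    (hGZK : rank_eq_analyticRank_of_analyticRank_le_one)
    (hU : Silverman1994_thmV53_tateUniformisation.{0})
    (hU2 : Silverman1994_thmV53_corV54_tateUniformisation.{0})
    {W F : WeierstrassCurve ℚ} [W.IsElliptic] [W.IsGloballyMinimal] [F.IsElliptic]
    (hWeq : W = ⟨0, 0, 0, -23728815, -26430993414⟩) (hFeq : F = ⟨0, 0, 0, -2636535, 978925682⟩)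
    (hr0 : W.analyticRank = 0) {q : ℚ} (hq : shaAn W = (q : ℂ)) (hv : padicValRat 5 q = 2)
    -- the HEEGNER DATUM (per-pair evidence; Cha 2005 Thm. 5.2's index certificate)
    {N : ℕ} [NeZero N] {K : Type} [Field K] [NumberField K] (hK : IsImaginaryQuadratic K)
    (hH : SatisfiesHeegnerHypothesis N K) {P : (W.baseChange K).toAffine.Point}
    (hP : IsHeegnerPoint N W K P) (hnt : ¬ IsOfFinAddOrder P)
    (hpD : ¬ (5 : ℤ) ∣ NumberField.discr K) (hpN : ¬ 5 ^ 2 ∣ N)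
    (hI : padicValNat 5 (AddSubgroup.zmultiples P).index ≤ 1)
    -- the congruence and the partner's data (as in the source offer)
    (θ : geomTorsion F (5 : ℤ) ≃+ geomTorsion W (5 : ℤ))
    (hθ : ∀ (σ : Field.absoluteGaloisGroup ℚ) (P : geomTorsion F (5 : ℤ)), θ (σ • P) = σ • θ P)
    (hrank : 2 ≤ F.mordellWeilRank)
    (h2 : ∀ w : HeightOneSpectrum (𝓞 ℚ), (primesEquiv w : ℕ) = 2 →
      Nat.card (nsmulAddMonoidHom 5 : (F.baseChange (w.adicCompletion ℚ)).toAffine.Point →+ _).ker = 1)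
    (h3 : ∀ w : HeightOneSpectrum (𝓞 ℚ), (primesEquiv w : ℕ) = 3 →
      Nat.card (nsmulAddMonoidHom 5 : (F.baseChange (w.adicCompletion ℚ)).toAffine.Point →+ _).ker = 1)
    (h5 : ∀ w : HeightOneSpectrum (𝓞 ℚ), (primesEquiv w : ℕ) = 5 →
      Nat.card (nsmulAddMonoidHom 5 : (F.baseChange (w.adicCompletion ℚ)).toAffine.Point →+ _).ker = 1)
    (h29 : ∀ w : HeightOneSpectrum (𝓞 ℚ), (primesEquiv w : ℕ) = 29 →
      Nat.card (nsmulAddMonoidHom 5 : (F.baseChange (w.adicCompletion ℚ)).toAffine.Point →+ _).ker = 1)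
    : BSDp W 5 := by
  haveI : Fact (Nat.Prime 5) := ⟨by norm_num⟩
  have hIW : integralModelInt W = ⟨0, 0, 0, -23728815, -26430993414⟩ :=
    integralModelInt_eq_of_map_eq _ (by rw [hWeq]; ext <;> simp [WeierstrassCurve.map])
  have hX : ClassX7 W 5 :=
    classX7_of_intModel 5 hIW (by decide +kernel) card_c363312bl1_5 (by decide) 2 (by norm_num) (by decide +kernel)
      (by decide +kernel)
  have hcm : ¬ W.HasCM := not_hasCM_c363312bl1 hWeq
  set L : List ℕ := [2, 3, 5, 29] with hL
  have hLp : ∀ q ∈ L, q.Prime := by decide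
  have hΔE : ∀ q : ℕ, q.Prime → (q : ℤ) ∣ (⟨0, 0, 0, -23728815, -26430993414⟩ : WeierstrassCurve ℤ).Δ → q ∈ L :=
    forall_mem_of_natAbs_eq_prod_pow L [8, 11, 0, 11] hLp (by decide +kernel)
  have hΔF : ∀ q : ℕ, q.Prime → (q : ℤ) ∣ (⟨0, 0, 0, -2636535, 978925682⟩ : WeierstrassCurve ℤ).Δ → q ∈ L :=
    forall_mem_of_natAbs_eq_prod_pow L [8, 5, 0, 11] hLp (by decide +kernel)
  set e := primesEquiv (R := 𝓞 ℚ) with he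
  set v₀ : HeightOneSpectrum (𝓞 ℚ) := e.symm ⟨5, Fact.out⟩ with hv₀def
  have hv₀ : (e v₀ : ℕ) = 5 := by rw [hv₀def, Equiv.apply_symm_apply]
  have heqp : ∀ w : HeightOneSpectrum (𝓞 ℚ), (e w : ℕ) = 5 → w = v₀ := by
    intro w hw
    have h1 : e w = ⟨5, Fact.out⟩ := Subtype.ext hw
    rw [hv₀def, ← h1, Equiv.symm_apply_apply]
  set S : Finset (HeightOneSpectrum (𝓞 ℚ)) :=
    (L.filterMap fun r ↦ if h : r.Prime then some (e.symm ⟨r, h⟩) else none).toFinset with hSdef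
  have hmemS : ∀ w : HeightOneSpectrum (𝓞 ℚ), w ∈ S ↔ (e w : ℕ) ∈ L := by
    intro w
    rw [hSdef, List.mem_toFinset, List.mem_filterMap]
    constructor
    · rintro ⟨r, hr, hrw⟩
      by_cases hrp : r.Prime
      · rw [dif_pos hrp, Option.some.injEq] at hrw
        rw [← hrw, Equiv.apply_symm_apply]
        exact hr
      · rw [dif_neg hrp] at hrw
        exact absurd hrw (by simp)
    · intro hw
      refine ⟨(e w : ℕ), hw, ?_⟩
      rw [dif_pos (e w).2]
      simp
  set T : Finset (HeightOneSpectrum (𝓞 ℚ)) := {v₀} with hTdef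
  have hTS : T ⊆ S := by
    intro w hw
    rw [hTdef, Finset.mem_singleton] at hw
    rw [hmemS, hw, hv₀]; decide
  have hS : ∀ w : HeightOneSpectrum (𝓞 ℚ), w ∉ S →
      W.HasGoodReductionAt w ∧ F.HasGoodReductionAt w ∧ ((5 : ℕ) : 𝓞 ℚ) ∉ w.asIdeal := by
    intro w hwS
    have hwL : (e w : ℕ) ∉ L := fun h ↦ hwS ((hmemS w).mpr h)
    have hq : (e w : ℕ).Prime := (e w).2
    refine ⟨?_, ?_, natCast_not_mem_of_primesEquiv_ne w Fact.out fun h ↦ hwL ?_⟩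
    · rw [hWeq]; exact hasGoodReductionAt_mk_of_primesEquiv _ _ _ _ _ w rfl fun h ↦ hwL (hΔE _ hq h)
    · rw [hFeq]; exact hasGoodReductionAt_mk_of_primesEquiv _ _ _ _ _ w rfl fun h ↦ hwL (hΔF _ hq h)
    · show (primesEquiv w : ℕ) ∈ L
      rw [h]; decide
  have hcardp : ∏ w ∈ T, Nat.card (w.adicCompletionIntegers ℚ ⧸
      Ideal.span {((5 : ℕ) : w.adicCompletionIntegers ℚ)}) = 5 ^ Module.finrank ℚ ℚ :=
    WeierstrassCurve.prod_natCard_quot_adicCompletionIntegers (K := ℚ) (p := 5) T fun w hw h ↦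
      hw (by rw [hTdef, Finset.mem_singleton]; exact heqp w (primesEquiv_eq_of_natCast_mem Fact.out h))
  have hT : (∏ w ∈ T, Nat.card (nsmulAddMonoidHom 5 :
        (F.baseChange (w.adicCompletion ℚ)).toAffine.Point →+ _).ker *
        Nat.card (w.adicCompletionIntegers ℚ ⧸
          Ideal.span {((5 : ℕ) : w.adicCompletionIntegers ℚ)})) < 5 ^ F.mordellWeilRank := by
    rw [Finset.prod_mul_distrib, hcardp, Module.finrank_self, hTdef, Finset.prod_singleton, h5 v₀ hv₀]
    calc (1 : ℕ) * 5 ^ 1 < 5 ^ 2 := by norm_num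
      _ ≤ 5 ^ F.mordellWeilRank := Nat.pow_le_pow_right (by norm_num) hrank
  have hplaces : ∀ w ∈ S, w ∉ T →
      (((5 : ℕ) : 𝓞 ℚ) ∉ w.asIdeal ∧ Nat.card (nsmulAddMonoidHom 5 :
          (F.baseChange (w.adicCompletion ℚ)).toAffine.Point →+ _).ker = 1) ∨
      (W.HasSplitMultiplicativeReductionAt w ∧ F.HasSplitMultiplicativeReductionAt w ∧
        Nat.card (nsmulAddMonoidHom 5 :
          (W.baseChange (w.adicCompletion ℚ)).toAffine.Point →+ _).ker ≤ 5) ∨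
      (W.HasMultiplicativeReductionAt w ∧ F.HasMultiplicativeReductionAt w ∧
        (∃ r : w.adicCompletion ℚ, algebraMap ℚ (w.adicCompletion ℚ) (-(W.c₄ / W.c₆)) =
          r ^ 2 * algebraMap ℚ (w.adicCompletion ℚ) (-(F.c₄ / F.c₆))) ∧
        (∀ ζ : w.adicCompletion ℚ, ζ ^ 5 = 1 → ζ = 1)) := by
    intro w hwS hwT
    have hwL : (e w : ℕ) ∈ L := (hmemS w).mp hwS
    have hw5 : (e w : ℕ) ≠ 5 := fun h ↦ hwT (by rw [hTdef, Finset.mem_singleton]; exact heqp w h)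
    have hcases : (e w : ℕ) = 2 ∨ (e w : ℕ) = 3 ∨ (e w : ℕ) = 29 := by
      simp only [hL, List.mem_cons, List.mem_nil_iff, or_false] at hwL
      omega
    rcases hcases with hw | hw | hw
    · exact Or.inl ⟨natCast_not_mem_of_primesEquiv_ne w Fact.out hw5, h2 w hw⟩
    · exact Or.inl ⟨natCast_not_mem_of_primesEquiv_ne w Fact.out hw5, h3 w hw⟩
    · exact Or.inl ⟨natCast_not_mem_of_primesEquiv_ne w Fact.out hw5, h29 w hw⟩
  exact X7RankZero.bsdp_of_casselsTate_of_congr_of_places_of_cha hCT hCha hGZK hU hU2 W 5 (by norm_num) hX hcm hr0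
    hq hv hK hH hP hnt hpD hpN hI F θ hθ S T hTS hS hT hplaces

/-- **`BSD(E,5)` for `363312bl1` (image `5Nn`), visible lower half + Cha's upper half, with the `5`-congruence PROVED in the
kernel** (modulo the named fact Fisher 2013 Thm. 5.8 `hF58`, the indirect family `X_E⁻(5)`): `F = 363312bg1` is ℚ-isomorphic
to the member `(λ : μ) = (−310068 : 7)` of the family of `E = 363312bl1` — the covariant identities with
`u = 911958727708987078801211118951857941118976` are the source's certificate (`bsdp_x7r0vis_363312bl1_5`), re-checked here by
`norm_num` on the closed forms.  Remaining binders: those of `bsdp_x7r0vischa_363312bl1_5_of_congr` minus `θ`, `hθ`.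
Per pair (an OFFER for referee A); NOT a class theorem; nothing booked. [cite: Fisher2013QuinticTwists, Thm. 5.8]
[cite: Miller2011LMS, Thm. 5.2 (arXiv:1010.2431 p. 11)] [cite: CremonaMazur2000, §3 and Table 1]
[cite: Cremona2006, Table 1 (Cremona labels 363312bl1, 363312bg1)] -/
theorem bsdp_x7r0vischa_363312bl1_5
    (hCT : exists_casselsTate_pairing (K := ℚ)) (hCha : Cha2005.thm52_padicValNat_shaOrder_le)
    (hGZK : rank_eq_analyticRank_of_analyticRank_le_one)
    (hU : Silverman1994_thmV53_tateUniformisation.{0})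
    (hU2 : Silverman1994_thmV53_corV54_tateUniformisation.{0}) (hF58 : thm58_fiveCongruent_hessePencilInd)
    {W F : WeierstrassCurve ℚ} [W.IsElliptic] [W.IsGloballyMinimal] [F.IsElliptic]
    (hWeq : W = ⟨0, 0, 0, -23728815, -26430993414⟩) (hFeq : F = ⟨0, 0, 0, -2636535, 978925682⟩)
    (hr0 : W.analyticRank = 0) {q : ℚ} (hq : shaAn W = (q : ℂ)) (hv : padicValRat 5 q = 2)
    {N : ℕ} [NeZero N] {K : Type} [Field K] [NumberField K] (hK : IsImaginaryQuadratic K)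
    (hH : SatisfiesHeegnerHypothesis N K) {P : (W.baseChange K).toAffine.Point}
    (hP : IsHeegnerPoint N W K P) (hnt : ¬ IsOfFinAddOrder P)
    (hpD : ¬ (5 : ℤ) ∣ NumberField.discr K) (hpN : ¬ 5 ^ 2 ∣ N)
    (hI : padicValNat 5 (AddSubgroup.zmultiples P).index ≤ 1)
    (hrank : 2 ≤ F.mordellWeilRank)
    (h2 : ∀ w : HeightOneSpectrum (𝓞 ℚ), (primesEquiv w : ℕ) = 2 →
      Nat.card (nsmulAddMonoidHom 5 : (F.baseChange (w.adicCompletion ℚ)).toAffine.Point →+ _).ker = 1)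
    (h3 : ∀ w : HeightOneSpectrum (𝓞 ℚ), (primesEquiv w : ℕ) = 3 →
      Nat.card (nsmulAddMonoidHom 5 : (F.baseChange (w.adicCompletion ℚ)).toAffine.Point →+ _).ker = 1)
    (h5 : ∀ w : HeightOneSpectrum (𝓞 ℚ), (primesEquiv w : ℕ) = 5 →
      Nat.card (nsmulAddMonoidHom 5 : (F.baseChange (w.adicCompletion ℚ)).toAffine.Point →+ _).ker = 1)
    (h29 : ∀ w : HeightOneSpectrum (𝓞 ℚ), (primesEquiv w : ℕ) = 29 →
      Nat.card (nsmulAddMonoidHom 5 : (F.baseChange (w.adicCompletion ℚ)).toAffine.Point →+ _).ker = 1)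
    : BSDp W 5 := by
  have hc4 : W.c₄ = (1138983120 : ℚ) := by
    subst hWeq; norm_num [WeierstrassCurve.c₄, WeierstrassCurve.b₂, WeierstrassCurve.b₄]
  have hc6 : W.c₆ = (22836378309696 : ℚ) := by
    subst hWeq; norm_num [WeierstrassCurve.c₆, WeierstrassCurve.b₂, WeierstrassCurve.b₄, WeierstrassCurve.b₆]
  have hc4F : F.c₄ = (126553680 : ℚ) := by
    subst hFeq; norm_num [WeierstrassCurve.c₄, WeierstrassCurve.b₂, WeierstrassCurve.b₄]
  have hc6F : F.c₆ = (-845791789248 : ℚ) := by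
    subst hFeq; norm_num [WeierstrassCurve.c₆, WeierstrassCurve.b₂, WeierstrassCurve.b₄, WeierstrassCurve.b₆]
  obtain ⟨θ, hθ⟩ := fiveCongruent_of_hesseIndCertificate hF58 W F (-310068 : ℚ) 7
    (911958727708987078801211118951857941118976 : ℚ) (by norm_num)
    (by rw [hc4, hc6, hc4F, eval_hesseC4ind]; norm_num) (by rw [hc4, hc6, hc6F, eval_hesseC6ind]; norm_num)
  exact bsdp_x7r0vischa_363312bl1_5_of_congr hCT hCha hGZK hU hU2 hWeq hFeq hr0 hq hv hK hH hP hnt hpD hpN hI θ hθ hrank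
    h2 h3 h5 h29

end Summit.BirchSwinnertonDyer.Rank1Residual.Supersingular

end
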